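import Literature.NumberTheory.EllipticCurves.ReciprocityLawDescent
import Literature.NumberTheory.EllipticCurves.ReciprocityLawTowerForm
import HarnessLib

/-!
# [REC-tower] from Kato's formula over the upper field with a constant from the lower field — the assembly of the generic layer

Topic `NumberTheory/EllipticCurves`; namespace `Literature.NumberTheory.EllipticCurves`. THEOREMS ONLY (no definition, no named fact, no
instance, no `sorry`). Assembly bricks for [REC-tower] (`tatePairingPoint_eq_trace_expStar_log_tower`) at the cells of crux K★
`stmt-BirchSwinnertonDyer-22226` (memo `Cruxes/StarredOptimalManinUnitFiveSeven/Lines/kato-lever-K3-legendre.md` §9). For a tower `K₀ ⊆ F₀ ⊆ F` of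
`p`-adic fields (`F/F₀` finite), an elliptic curve `W/K₀`, a `Γ_{K₀}`-equivariant level-compatible Weil tower `e`, and `γ = towerConjElement K₀ F₀ F`
(whose inverse IS an embedding element of the tower, `GaloisRepresentations.absClosureEmbedding_tower_eq_towerConjElement_inv_smul`):

* ★ `tatePairingPointTower_pullback_eq_finrank_mul` — (DEG-tower) `⟨[η₀ ∘ res], P₀.map (F₀ → F)⟩_tower = [F : F₀] · ⟨[η₀], P₀⟩_{F₀}` for the tree's
  tower pairing `tatePairingPointTower`, every `η₀ ∈ Z¹(Γ_{F₀}, T_pW)`, `P₀ ∈ E(F₀)` (`tatePairingPoint_res_map` at `τ = γ⁻¹`).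
* ★★ `tatePairingPoint_eq_trace_of_direct_towerConj` — the DESCENT `ReciprocityLawDescent.tatePairingPoint_eq_trace_of_res` run at `τ = γ⁻¹`: Kato's
  formula over `F` for the DIRECT representation at the datum `d.map V(γ⁻¹)` (all cocycles, all points; constant `c ∈ F`) gives the formula over `F₀`
  with `c₀ = [F:F₀]⁻¹ Tr_{F/F₀}(c)` — same datum and element as the tower-form theorem `tatePairingPointTower_eq_trace_of_direct` (G6).
* ★★★ `tatePairingPoint_tower_clauses_of_direct` — BOTH clauses of [REC-tower] (lower: `tatePairingPoint` over `F₀`, `exp*_{d₀}`, constant `c₀`;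
  upper: `tatePairingPointTower`, `expStarCoordTower d`, constant `algebraMap c₀`, ALL tower cocycles) from ONE input: Kato's formula over `F` for the
  direct representation `T_pW|_{Γ_F}` at the datum `d.map V(γ⁻¹)` with a constant OF THE FORM `algebraMap F₀ F c₀`, under the Prop-1.2.3 binders of
  the tower representation, hT₂'s compatibility clause `hcomp` for `(d₀, d)` and the functoriality `hlog` of `log_ω`
  (`Tr_{F/F₀}(algebraMap c₀) = [F:F₀]·c₀`). What a cell must still supply: that formula (⟸ (K₂) + descent from the field of good reduction) with its
  constant in `F₀` (G5), and `c₀ ≠ 0`.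
* `trace_algebraMap_of_baseChange_algEquiv` — `Tr_{F'/A}(algebraMap b) = algebraMap (Tr_{B/R} b)` when `F' ≅ A ⊗_R B` (trace half of G5 for the
  linearly disjoint compositum `K_v(μ_m) = ℚ_p(μ_m) ⊗ K_v`).

BSD / K★ / [REC-tower] are NOT proved by this file.

## References
* K. Kato, LNM 1553 (1993), Ch. II §1.2.4, Thm. 1.4.1 (4). [Kato1993LNM1553]
* J.-P. Serre, *Local Fields* (1979), XIII §3 Prop. 7; *Galois Cohomology* (1997), I §2.4, I §5.8. [SerreLocalFields1979] [SerreGaloisCohomology1997]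
* J. Neukirch, A. Schmidt, K. Wingberg (2008), (7.1.4), (7.2.6). [NeukirchSchmidtWingberg2008]
* J. Neukirch, *Algebraic Number Theory* (1999), Ch. I §2. [NeukirchANT1999]
-/

noncomputable section

open scoped Classical NNReal TensorProduct
open CategoryTheory Function Field ValuativeRel
open Literature.NumberTheory.GaloisRepresentations
open Literature.NumberTheory.GaloisRepresentations.IsNonarchimedeanLocalField
open Literature.NumberTheory.PAdicHodge

namespace Literature.NumberTheory.EllipticCurves

open _root_.WeierstrassCurve

variable {K₀ : Type} [Field K₀] [CharZero K₀] (W : WeierstrassCurve K₀) [W.IsElliptic]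
  -- the lower field
  (F₀ : Type) [Field F₀] [Algebra K₀ F₀] [ValuativeRel F₀] [TopologicalSpace F₀] [IsNonarchimedeanLocalField F₀] [CharZero F₀]
  {p : ℕ} [Fact p.Prime] [Fact (¬ IsUnit (p : integerC F₀))] [IsAdicComplete (Ideal.span {(p : integerC F₀)}) (integerC F₀)]
  (hp₀ : valuation F₀ p < 1) [Algebra ℚ_[p] F₀] [FiniteDimensional ℚ_[p] F₀]
  (w₀ : Valuation F₀ ℝ≥0) [(W.baseChange F₀).IsIntegral w₀.integer]
  -- the upper field
  (F : Type) [Field F] [Algebra K₀ F] [Algebra F₀ F] [IsScalarTower K₀ F₀ F] [ValuativeRel F] [TopologicalSpace F]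
  [IsNonarchimedeanLocalField F] [CharZero F] [Fact (¬ IsUnit (p : integerC F))]
  [IsAdicComplete (Ideal.span {(p : integerC F)}) (integerC F)]
  (hp : valuation F p < 1) [Algebra ℚ_[p] F] [IsScalarTower ℚ_[p] F₀ F] [FiniteDimensional F₀ F]
  (w : Valuation F ℝ≥0) [(W.baseChange F).IsIntegral w.integer]
  -- the Weil tower
  (e : (k : ℕ) → geomTorsion W ((p ^ k : ℕ) : ℤ) → geomTorsion W ((p ^ k : ℕ) : ℤ) → AlgebraicClosure K₀)
  (hμ : ∀ k S T, e k S T ^ (p ^ k) = 1) (hadd₁ : ∀ k S₁ S₂ T, e k (S₁ + S₂) T = e k S₁ T * e k S₂ T)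
  (hadd₂ : ∀ k S T₁ T₂, e k S (T₁ + T₂) = e k S T₁ * e k S T₂)
  (hgal : ∀ k (σ : absoluteGaloisGroup K₀) (S T : geomTorsion W ((p ^ k : ℕ) : ℤ)), σ • e k S T = e k (σ • S) (σ • T))
  (hcompat : ∀ k (S T : geomTorsion W ((p ^ (k + 1) : ℕ) : ℤ)),
    e k (torsionMulHom W (p ^ (k + 1)) (p ^ k) p (pow_succ p k).symm S)
      (torsionMulHom W (p ^ (k + 1)) (p ^ k) p (pow_succ p k).symm T) = e (k + 1) S T ^ p)
  -- the intertwiner `V(γ⁻¹)`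
  {gV : W.rationalTateModule p ≃ₗ[ℚ_[p]] W.rationalTateModule p}
  (hgVdef : ∀ m, gV m = (W.rationalTateGaloisRep p (W.continuous_rationalGaloisRepTate_holds p)) (towerConjElement K₀ F₀ F)⁻¹ m)

/-! ### §1 (DEG-tower): the restriction degree formula for the tower pairing -/

omit [Fact (¬ IsUnit (p : integerC F₀))] [IsAdicComplete (Ideal.span {(p : integerC F₀)}) (integerC F₀)]
  [Algebra ℚ_[p] F₀] [FiniteDimensional ℚ_[p] F₀] [Fact (¬ IsUnit (p : integerC F))]
  [IsAdicComplete (Ideal.span {(p : integerC F)}) (integerC F)] [Algebra ℚ_[p] F] [IsScalarTower ℚ_[p] F₀ F] in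
/-- ★ **The restriction degree formula for the tower pairing**: `⟨[η₀ ∘ res_{F/F₀}], P₀.map (F₀ → F)⟩_tower = [F : F₀] · ⟨[η₀], P₀⟩_{F₀}`
for every crossed homomorphism `η₀` of `T_pW|_{Γ_{F₀}}` and every `P₀ ∈ E(F₀)` (`γ⁻¹`, `γ = towerConjElement K₀ F₀ F` the element behind
`tatePairingPointTower`, is an embedding element of the tower; the two transported cocycles `T(γ⁻¹) ∘ η₀ ∘ res` agree on the nose).
[cite: SerreLocalFields1979, XIII §3 Prop. 7] [cite: NeukirchSchmidtWingberg2008, (7.1.4) and (7.2.6)] [cite: SerreGaloisCohomology1997, I §2.4 (compatible pairs) with I §5.8] -/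
theorem tatePairingPointTower_pullback_eq_finrank_mul
    (η₀ : contOneCocycles (restrictedTateRep W F₀ p).toTopRep) (P₀ : (W.baseChange F₀).toAffine.Point) :
    tatePairingPointTower W F₀ e hμ hadd₁ hadd₂ hgal hcompat
        (oneCocycleClass _ (contOneCocycles.pullback (absGaloisRestrict F₀ F) (𝟙 _) η₀))
        (WeierstrassCurve.Affine.Point.map (IsScalarTower.toAlgHom K₀ F₀ F) P₀) =
      (Module.finrank F₀ F : ℤ_[p]) * tatePairingPoint W F₀ p e hμ hadd₁ hadd₂ hgal hcompat (oneCocycleClass _ η₀) P₀ := by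
  have hγ := absClosureEmbedding_tower_eq_towerConjElement_inv_smul K₀ F₀ F
  rw [tatePairingPointTower_apply, cohomologyMap_oneCocycleClass,
    ← tatePairingPoint_res_map W F₀ F e hμ hadd₁ hadd₂ hgal hcompat hγ
      (absGaloisRestrict_eq_conj_of_towerEmb F₀ F hγ) (oneCocycleClass _ η₀) P₀,
    map_oneCocycleClass]
  -- the two transported cocycles `σ ↦ T(γ⁻¹) (η₀ (res σ))` agree on the nose
  exact congrArg (fun y => tatePairingPoint W F p e hμ hadd₁ hadd₂ hgal hcompat y
      (WeierstrassCurve.Affine.Point.map (IsScalarTower.toAlgHom K₀ F₀ F) P₀))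
    (congrArg (oneCocycleClass _) (Subtype.ext (ContinuousMap.ext fun σ => rfl)))

/-! ### §2 The descent run at `τ = γ⁻¹` -/

include hgal hgVdef in
/-- ★★ **Kato's formula descends along `F/F₀` — at the element `γ⁻¹` behind `tatePairingPointTower`.** If the formula holds over `F` for the DIRECT
representation `T_pW|_{Γ_F}` at the datum `d.map V(γ⁻¹)` with constant `c ∈ F` (all cocycles, all points), then under the Prop-1.2.3 binders of the
tower representation, the compatibility clause `hcomp` for `(d₀, d)` and the functoriality `hlog` of `log_ω`, the formula holds over `F₀` with the
constant `[F:F₀]⁻¹ · Tr_{F/F₀}(c)`. [cite: Kato1993LNM1553, Ch. II §1.2.4 and Thm. 1.4.1 (4)] [cite: SerreLocalFields1979, XIII §3 Prop. 7] -/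
theorem tatePairingPoint_eq_trace_of_direct_towerConj
    (hinj : (bdRPeriodRingData (F := F) (p := p) hp).CupLogInjective (logCyclotomic p)
      ((restrictedRationalTateRep W F₀ p).restrict (absGaloisRestrict F₀ F)))
    (hde : ∀ z : contOneCocycles ((restrictedRationalTateRep W F₀ p).restrict (absGaloisRestrict F₀ F)).toTopRep,
      (bdRPeriodRingData (F := F) (p := p) hp).HasDualExp (logCyclotomic p)
        ((restrictedRationalTateRep W F₀ p).restrict (absGaloisRestrict F₀ F)) fun σ => z.1 σ)
    (d₀ : (bdRPeriodRingData (F := F₀) (p := p) hp₀).FilZeroLine (restrictedRationalTateRep W F₀ p))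
    (d : (bdRPeriodRingData (F := F) (p := p) hp).FilZeroLine ((restrictedRationalTateRep W F₀ p).restrict (absGaloisRestrict F₀ F)))
    (hcomp : ∀ (η₀ : contOneCocycles (restrictedTateRep W F₀ p).toTopRep)
        (η : contOneCocycles ((restrictedTateRep W F₀ p).restrict (absGaloisRestrict F₀ F)).toTopRep),
        (∀ σ, η.1 σ = η₀.1 (absGaloisRestrict F₀ F σ)) →
        expStarCoordTower W hp d η = algebraMap F₀ F (expStarCoord W hp₀ d₀ η₀))
    (hlog : ∀ P₀ : (W.baseChange F₀).toAffine.Point,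
      FormalGroupChart.padicLogPointFiniteExt w (W.baseChange F) p
          (WeierstrassCurve.Affine.Point.map (IsScalarTower.toAlgHom K₀ F₀ F) P₀) =
        algebraMap F₀ F (FormalGroupChart.padicLogPointFiniteExt w₀ (W.baseChange F₀) p P₀))
    (c : F)
    (hrec : ∀ (η' : contOneCocycles (restrictedTateRep W F p).toTopRep) (P : (W.baseChange F).toAffine.Point),
      ((tatePairingPoint W F p e hμ hadd₁ hadd₂ hgal hcompat (oneCocycleClass _ η') P : ℤ_[p]) : ℚ_[p]) =
        Algebra.trace ℚ_[p] F
          (c * expStarCoord W hp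
              (d.map gV (ratGalEquiv_intertwines W F₀ (absGaloisRestrict_eq_conj_towerConjElement_inv F₀ F) hgVdef)) η' *
            FormalGroupChart.padicLogPointFiniteExt w (W.baseChange F) p P))
    (η₀ : contOneCocycles (restrictedTateRep W F₀ p).toTopRep) (P₀ : (W.baseChange F₀).toAffine.Point) :
    ((tatePairingPoint W F₀ p e hμ hadd₁ hadd₂ hgal hcompat (oneCocycleClass _ η₀) P₀ : ℤ_[p]) : ℚ_[p]) =
      Algebra.trace ℚ_[p] F₀
        (((Module.finrank F₀ F : F₀)⁻¹ * Algebra.trace F₀ F c) * expStarCoord W hp₀ d₀ η₀ *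
          FormalGroupChart.padicLogPointFiniteExt w₀ (W.baseChange F₀) p P₀) :=
  tatePairingPoint_eq_trace_of_res W F₀ hp₀ w₀ F hp w e hμ hadd₁ hadd₂ hgal hcompat
    (absClosureEmbedding_tower_eq_towerConjElement_inv_smul K₀ F₀ F) (absGaloisRestrict_eq_conj_towerConjElement_inv F₀ F) hgVdef
    hinj hde d₀ d hcomp hlog c (fun _ _ => hrec _ _) η₀ P₀

/-! ### §3 Both clauses of [REC-tower] from the direct formula with a constant from `F₀` -/

include hgal hgVdef in
/-- ★★★ **Both clauses of [REC-tower] from ONE input.** If Kato's formula holds over `F` for the DIRECT representation `T_pW|_{Γ_F}` at the datum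
`d.map V(γ⁻¹)` with a constant of the form `algebraMap F₀ F c₀` (all cocycles, all points), then — under the Prop-1.2.3 binders of the tower
representation, hT₂'s clause `hcomp` for `(d₀, d)` and `hlog` — (lower) `⟨[η₀], P₀⟩_{F₀} = Tr_{F₀/ℚ_p}(c₀ · exp*_{d₀}(η₀) · log_ω P₀)` for all `η₀`, `P₀`,
AND (upper) `⟨[η], P⟩_tower = Tr_{F/ℚ_p}(algebraMap c₀ · exp*_d(η) · log_ω P)` for all tower cocycles `η` and all `P ∈ E(F)` — the conclusion of
[REC-tower] for `(W, F₀ ⊆ F, e, d₀, d)` except `c₀ ≠ 0`. (`Tr_{F/F₀}(algebraMap c₀) = [F:F₀]·c₀`.)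
[cite: Kato1993LNM1553, Ch. II §1.2.4 and Thm. 1.4.1 (4)] [cite: SerreLocalFields1979, XIII §3 Prop. 7] [cite: NeukirchSchmidtWingberg2008, (7.2.6)] -/
theorem tatePairingPoint_tower_clauses_of_direct
    (hinj : (bdRPeriodRingData (F := F) (p := p) hp).CupLogInjective (logCyclotomic p)
      ((restrictedRationalTateRep W F₀ p).restrict (absGaloisRestrict F₀ F)))
    (hde : ∀ z : contOneCocycles ((restrictedRationalTateRep W F₀ p).restrict (absGaloisRestrict F₀ F)).toTopRep,
      (bdRPeriodRingData (F := F) (p := p) hp).HasDualExp (logCyclotomic p)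
        ((restrictedRationalTateRep W F₀ p).restrict (absGaloisRestrict F₀ F)) fun σ => z.1 σ)
    (d₀ : (bdRPeriodRingData (F := F₀) (p := p) hp₀).FilZeroLine (restrictedRationalTateRep W F₀ p))
    (d : (bdRPeriodRingData (F := F) (p := p) hp).FilZeroLine ((restrictedRationalTateRep W F₀ p).restrict (absGaloisRestrict F₀ F)))
    (hcomp : ∀ (η₀ : contOneCocycles (restrictedTateRep W F₀ p).toTopRep)
        (η : contOneCocycles ((restrictedTateRep W F₀ p).restrict (absGaloisRestrict F₀ F)).toTopRep),
        (∀ σ, η.1 σ = η₀.1 (absGaloisRestrict F₀ F σ)) →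
        expStarCoordTower W hp d η = algebraMap F₀ F (expStarCoord W hp₀ d₀ η₀))
    (hlog : ∀ P₀ : (W.baseChange F₀).toAffine.Point,
      FormalGroupChart.padicLogPointFiniteExt w (W.baseChange F) p
          (WeierstrassCurve.Affine.Point.map (IsScalarTower.toAlgHom K₀ F₀ F) P₀) =
        algebraMap F₀ F (FormalGroupChart.padicLogPointFiniteExt w₀ (W.baseChange F₀) p P₀))
    (c₀ : F₀)
    (hrec : ∀ (η' : contOneCocycles (restrictedTateRep W F p).toTopRep) (P : (W.baseChange F).toAffine.Point),
      ((tatePairingPoint W F p e hμ hadd₁ hadd₂ hgal hcompat (oneCocycleClass _ η') P : ℤ_[p]) : ℚ_[p]) =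
        Algebra.trace ℚ_[p] F
          (algebraMap F₀ F c₀ * expStarCoord W hp
              (d.map gV (ratGalEquiv_intertwines W F₀ (absGaloisRestrict_eq_conj_towerConjElement_inv F₀ F) hgVdef)) η' *
            FormalGroupChart.padicLogPointFiniteExt w (W.baseChange F) p P)) :
    (∀ (η₀ : contOneCocycles (restrictedTateRep W F₀ p).toTopRep) (P₀ : (W.baseChange F₀).toAffine.Point),
        ((tatePairingPoint W F₀ p e hμ hadd₁ hadd₂ hgal hcompat (oneCocycleClass _ η₀) P₀ : ℤ_[p]) : ℚ_[p]) =
          Algebra.trace ℚ_[p] F₀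
            (c₀ * expStarCoord W hp₀ d₀ η₀ * FormalGroupChart.padicLogPointFiniteExt w₀ (W.baseChange F₀) p P₀)) ∧
      ∀ (η : contOneCocycles ((restrictedTateRep W F₀ p).restrict (absGaloisRestrict F₀ F)).toTopRep)
        (P : (W.baseChange F).toAffine.Point),
        ((tatePairingPointTower W F₀ e hμ hadd₁ hadd₂ hgal hcompat (oneCocycleClass _ η) P : ℤ_[p]) : ℚ_[p]) =
          Algebra.trace ℚ_[p] F
            (algebraMap F₀ F c₀ * expStarCoordTower W hp d η * FormalGroupChart.padicLogPointFiniteExt w (W.baseChange F) p P) := by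
  refine ⟨fun η₀ P₀ => ?_, fun η P =>
    tatePairingPointTower_eq_trace_of_direct W F₀ hp hgVdef w e hμ hadd₁ hadd₂ hgal hcompat hinj hde d (algebraMap F₀ F c₀) hrec η P⟩
  have h := tatePairingPoint_eq_trace_of_direct_towerConj W F₀ hp₀ w₀ F hp w e hμ hadd₁ hadd₂ hgal hcompat hgVdef
    hinj hde d₀ d hcomp hlog (algebraMap F₀ F c₀) hrec η₀ P₀
  have hn₀ : (Module.finrank F₀ F : F₀) ≠ 0 := Nat.cast_ne_zero.mpr Module.finrank_pos.ne'
  rwa [Algebra.trace_algebraMap, nsmul_eq_mul, inv_mul_cancel_left₀ hn₀] at h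

/-! ### §4 Trace bookkeeping for the one-constant step (G5): the trace under base change -/

/-- **`Tr_{F'/A}(b) = Tr_{B/R}(b)` read in `A`, when `F' = A ⊗_R B`** (an `A`-algebra isomorphism `e : A ⊗[R] B ≃ F'` with
`e (1 ⊗ b) = algebraMap B F' b`; e.g. `R = ℚ_p`, `A = ℚ_p(μ_m)`, `B = K_v` totally ramified, `F' = K_v(μ_m)`: the linearly disjoint compositum).
This is the trace half of the one-constant step (G5) of memo §9.3: after descent the lower and upper constants are `[K_v:ℚ_p]⁻¹·Tr_{K_v/ℚ_p}(c)` and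
`[F':A]⁻¹·Tr_{F'/A}(algebraMap c)`, which agree by this lemma. (`Algebra.baseChange_lmul` + `LinearMap.trace_baseChange`.) [cite: NeukirchANT1999, Ch. I §2 (trace and norm under base change)] -/
theorem trace_algebraMap_of_baseChange_algEquiv {R A B F' : Type*} [CommRing R] [CommRing A] [CommRing B] [CommRing F']
    [Algebra R A] [Algebra R B] [Algebra A F'] [Algebra B F'] [Module.Free R B] [Module.Finite R B]
    (e : TensorProduct R A B ≃ₐ[A] F') (he : ∀ b : B, e (1 ⊗ₜ[R] b) = algebraMap B F' b) (b : B) :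
    Algebra.trace A F' (algebraMap B F' b) = algebraMap R A (Algebra.trace R B b) := by
  rw [← he, Algebra.trace_eq_of_algEquiv, Algebra.trace_apply, ← Algebra.baseChange_lmul, LinearMap.trace_baseChange,
    ← Algebra.trace_apply]

/-! ### §5 The constant is nonzero as soon as `E(F₀)` has a nonzero `ℤ_p`-valued additive functional -/

omit [Fact (¬ IsUnit (p : integerC F₀))] [IsAdicComplete (Ideal.span {(p : integerC F₀)}) (integerC F₀)] [FiniteDimensional ℚ_[p] F₀] in
/-- **The constant of Kato's formula is nonzero**: if `⟨[η₀], P₀⟩ = Tr_{F₀/ℚ_p}(c · a(η₀) · log_ω P₀)` for all `η₀`, `P₀` (any coefficient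
function `a`), the Weil tower is non-degenerate and `E(F₀)` carries a nonzero additive `φ : E(F₀) → ℤ_p`, then `c ≠ 0` — otherwise every
`⟨[η₀], ·⟩` vanishes, contradicting Tate duality [TD] (`exists_contOneCocycles_tatePairingPoint_eq`: `φ = ⟨[η], ·⟩` for some `η`).
[cite: BlochKato1990, Prop. 3.8 (p. 354)] [cite: MilneADT2006, I Cor. 2.3 and I §3 Cor. 3.4] -/
theorem ne_zero_of_tatePairingPoint_eq_trace
    (hnondeg : ∀ k (T : geomTorsion W ((p ^ k : ℕ) : ℤ)), (∀ S, e k S T = 1) → T = 0)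
    (a : contOneCocycles (restrictedTateRep W F₀ p).toTopRep → F₀) (c : F₀)
    (hrec : ∀ (η₀ : contOneCocycles (restrictedTateRep W F₀ p).toTopRep) (P₀ : (W.baseChange F₀).toAffine.Point),
      ((tatePairingPoint W F₀ p e hμ hadd₁ hadd₂ hgal hcompat (oneCocycleClass _ η₀) P₀ : ℤ_[p]) : ℚ_[p]) =
        Algebra.trace ℚ_[p] F₀ (c * a η₀ * FormalGroupChart.padicLogPointFiniteExt w₀ (W.baseChange F₀) p P₀))
    (hφ : ∃ φ : (W.baseChange F₀).toAffine.Point →+ ℤ_[p], φ ≠ 0) : c ≠ 0 := by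
  rintro rfl
  obtain ⟨φ, hφ⟩ := hφ
  obtain ⟨η, hη⟩ := exists_contOneCocycles_tatePairingPoint_eq W e hμ hadd₁ hadd₂ hgal hnondeg hcompat φ
  refine hφ (AddMonoidHom.ext fun P => ?_)
  have h := hrec η P
  rw [hη P, zero_mul, zero_mul, map_zero] at h
  rw [AddMonoidHom.zero_apply]
  exact PadicInt.coe_eq_zero.1 h

/-! ### §6 The conclusion of [REC-tower] for `(W, F₀ ⊆ F, e, d₀, d)`, packaged -/

include hgal hgVdef in
/-- ★★★ **The body of [REC-tower] for `(W, F₀ ⊆ F, e, d₀, d)` from Kato's formula over `F` with a constant from `F₀`.** Under the hypotheses of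
`tatePairingPoint_tower_clauses_of_direct`, non-degeneracy of the Weil tower and the existence of a nonzero additive `E(F₀) → ℤ_p`:
`∃ c ∈ F₀, c ≠ 0 ∧ (lower clause with c) ∧ (upper clause with algebraMap c)` — verbatim the conclusion of
`tatePairingPoint_eq_trace_expStar_log_tower` at these arguments. [cite: Kato1993LNM1553, Ch. II §1.2.4 and Thm. 1.4.1 (4)]
[cite: BlochKato1990, Prop. 3.8 (p. 354)] [cite: SerreLocalFields1979, XIII §3 Prop. 7] -/
theorem exists_const_tower_clauses_of_direct
    (hnondeg : ∀ k (T : geomTorsion W ((p ^ k : ℕ) : ℤ)), (∀ S, e k S T = 1) → T = 0)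
    (hinj : (bdRPeriodRingData (F := F) (p := p) hp).CupLogInjective (logCyclotomic p)
      ((restrictedRationalTateRep W F₀ p).restrict (absGaloisRestrict F₀ F)))
    (hde : ∀ z : contOneCocycles ((restrictedRationalTateRep W F₀ p).restrict (absGaloisRestrict F₀ F)).toTopRep,
      (bdRPeriodRingData (F := F) (p := p) hp).HasDualExp (logCyclotomic p)
        ((restrictedRationalTateRep W F₀ p).restrict (absGaloisRestrict F₀ F)) fun σ => z.1 σ)
    (d₀ : (bdRPeriodRingData (F := F₀) (p := p) hp₀).FilZeroLine (restrictedRationalTateRep W F₀ p))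
    (d : (bdRPeriodRingData (F := F) (p := p) hp).FilZeroLine ((restrictedRationalTateRep W F₀ p).restrict (absGaloisRestrict F₀ F)))
    (hcomp : ∀ (η₀ : contOneCocycles (restrictedTateRep W F₀ p).toTopRep)
        (η : contOneCocycles ((restrictedTateRep W F₀ p).restrict (absGaloisRestrict F₀ F)).toTopRep),
        (∀ σ, η.1 σ = η₀.1 (absGaloisRestrict F₀ F σ)) →
        expStarCoordTower W hp d η = algebraMap F₀ F (expStarCoord W hp₀ d₀ η₀))
    (hlog : ∀ P₀ : (W.baseChange F₀).toAffine.Point,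
      FormalGroupChart.padicLogPointFiniteExt w (W.baseChange F) p
          (WeierstrassCurve.Affine.Point.map (IsScalarTower.toAlgHom K₀ F₀ F) P₀) =
        algebraMap F₀ F (FormalGroupChart.padicLogPointFiniteExt w₀ (W.baseChange F₀) p P₀))
    (c₀ : F₀)
    (hrec : ∀ (η' : contOneCocycles (restrictedTateRep W F p).toTopRep) (P : (W.baseChange F).toAffine.Point),
      ((tatePairingPoint W F p e hμ hadd₁ hadd₂ hgal hcompat (oneCocycleClass _ η') P : ℤ_[p]) : ℚ_[p]) =
        Algebra.trace ℚ_[p] F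
          (algebraMap F₀ F c₀ * expStarCoord W hp
              (d.map gV (ratGalEquiv_intertwines W F₀ (absGaloisRestrict_eq_conj_towerConjElement_inv F₀ F) hgVdef)) η' *
            FormalGroupChart.padicLogPointFiniteExt w (W.baseChange F) p P))
    (hφ : ∃ φ : (W.baseChange F₀).toAffine.Point →+ ℤ_[p], φ ≠ 0) :
    ∃ c : F₀, c ≠ 0 ∧
      (∀ (η₀ : contOneCocycles (restrictedTateRep W F₀ p).toTopRep) (P₀ : (W.baseChange F₀).toAffine.Point),
        ((tatePairingPoint W F₀ p e hμ hadd₁ hadd₂ hgal hcompat (oneCocycleClass _ η₀) P₀ : ℤ_[p]) : ℚ_[p]) =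
          Algebra.trace ℚ_[p] F₀
            (c * expStarCoord W hp₀ d₀ η₀ * FormalGroupChart.padicLogPointFiniteExt w₀ (W.baseChange F₀) p P₀)) ∧
      ∀ (η : contOneCocycles ((restrictedTateRep W F₀ p).restrict (absGaloisRestrict F₀ F)).toTopRep)
        (P : (W.baseChange F).toAffine.Point),
        ((tatePairingPointTower W F₀ e hμ hadd₁ hadd₂ hgal hcompat (oneCocycleClass _ η) P : ℤ_[p]) : ℚ_[p]) =
          Algebra.trace ℚ_[p] F
            (algebraMap F₀ F c * expStarCoordTower W hp d η * FormalGroupChart.padicLogPointFiniteExt w (W.baseChange F) p P) := by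
  have h := tatePairingPoint_tower_clauses_of_direct W F₀ hp₀ w₀ F hp w e hμ hadd₁ hadd₂ hgal hcompat hgVdef
    hinj hde d₀ d hcomp hlog c₀ hrec
  exact ⟨c₀, ne_zero_of_tatePairingPoint_eq_trace W F₀ w₀ e hμ hadd₁ hadd₂ hgal hcompat hnondeg
    (fun η₀ => expStarCoord W hp₀ d₀ η₀) c₀ h.1 hφ, h.1, h.2⟩

end Literature.NumberTheory.EllipticCurves

end
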